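import Literature.AlgebraicGeometry.Frobenioids.PadicFrobenioidPairIsoDescent
import Literature.AlgebraicGeometry.Frobenioids.PadicFrobenioidPairIsoColimits
import Literature.AlgebraicGeometry.Frobenioids.PadicFrobenioidRelCosetBase
import Literature.AlgebraicGeometry.Frobenioids.PadicFieldwiseSaturatedGaloisBase
import HarnessLib

/-!
# Frobenioids II, Thm. 2.4 (ii): the printed `G₁ ⥲ G₂` with `G := Im(Π → G_{ℚ_p})` — the pair descends to the images

Mochizuki, *The geometry of Frobenioids II*, Kyushu J. Math. **62** (2008) 401–460, §2: setting of Definition 2.2, p. 17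
ll. 2–8 [cite: MochizukiFrdII2008, Def 2.2 p.17]: "`D` is any category `𝓑^temp(Π, Π°)⁰` as in Example 1.3, (iii), where
`Π → Q`, `G_{ℚ_p} ↠ Q` … is an isomorphism. Write `G := Im(Π) ⊆ Q`"; Theorem 2.4, p. 19: "`Ψ` … induces … `Π₁ ⥲ Π₂` … that
lies over an outer isomorphism … `G₁ ⥲ G₂`"; proof of (ii), p. 20 l.−5 – p. 21 l. 6 [cite: MochizukiFrdII2008, Thm 2.4 (ii) p.21]:
"`Ψ` induces a pair of compatible isomorphisms `G₁ ⥲ G₂`; `K̄₁^× ⥲ K̄₂^×`".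

PROOF-ONLY companion (cell abc-iut, `plan/L1/SUBDAG-FrdII-Thm24.md` row W12-L17 `PairIso`, node FrdII:Thm2.4(ii); the
residual named in abc-iut-w5-d229's HANDOFF #3).  abc-iut-w5-d194's `BaseGaloisSystem.exists_pairIso` gives the pair at
the `Π`-level (`φ : Π₁ ≃* Π₂`, a `φ`-equivariant `e : lim→ K₁^× ≅ lim→ K₂^×`) over the small bases `CosetCat Πᵢ` with an
ARBITRARY base functor; `PadicFrobenioidPairIsoDescent` descends `φ` to the quotients by the kernels of the deck actions.
Here, at the GENUINE base functor of §2, `CosetCat.push φ ⋙ CosetCat.toConnected ⋙ QuasiTemperoid.galoisPadicFields p`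
(`Π/U ↦ Spec ℚ̄_p^{Stab}` through an open homomorphism `φ : Π → G_{ℚ_p}`; the `CosetCat Π`-form of `PadicFrd.relBaseGal`):
* `genuine_map_crightMul_apply` — ACTION FORMULA: `r_g` acts on `K_{Π/M} = ℚ̄_p^{x φ(M) x⁻¹}` as `a ↦ (x φ(g) x⁻¹)·a`;
* `colimMap_toAutCoset_genuine_eq_id_iff` — **the kernel of the deck action of `Π` on `lim→_k K_{Π/N_k}^×` is `Ker φ`**
  (`G_{ℚ_p}` acts faithfully on `ℚ̄_p`; every `b ∈ ℚ̄_p` lies in `K_{Π/N_k}` for `k ≫ 0`), so the faithful quotient of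
  p427375 IS print's `G = Im(Π → G_{ℚ_p})`;
* `exists_rangeEquiv_of_equivariant` — every `φ`-equivariant pair maps `Ker φ₁` onto `Ker φ₂` and DESCENDS to
  `ψ : Im φ₁ ≃* Im φ₂` with `ψ (φ₁ g) = φ₂ (φ g)` — **the printed `G₁ ⥲ G₂`**;
* `exists_pairIso_range` — the assembled printed statement for fieldwise saturated data over the genuine bases;
* `exists_pairIso_range_zero` — non-vacuity: `C₀|_D` over any genuine base meets every hypothesis (at `Π = G_{ℚ_p}`,
  `φ = id`: `isTempered_galFbar`, `secondCountableTopology_galFbar_padic`, `⟨continuous_id, IsOpenMap.id⟩`).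
Theorems only; no new definitions; nothing here bears on [IUTchIII] Cor. 3.12.
-/

noncomputable section

namespace Literature.AlgebraicGeometry.Frobenioids

open CategoryTheory CategoryTheory.Limits Opposite Topology Filter
open Literature.AnabelianGeometry.SemiGraphs QuasiTemperoid

/-! ### §0 Generic: the transition maps of `B₀|_D = (Spec K ↦ K^×)` are injective -/

namespace PadicFrd

universe v u

/-- Along any morphism of the base, `B₀(f) : K_Y^× → K_X^×` is injective (a ring homomorphism of fields is injective).
[cite: MochizukiFrdII2008, Ex 1.1 (i) p.7] -/
theorem bZeroOn_map_injective {D : Type u} [Category.{v} D] {p : ℕ} [Fact p.Prime] (base : D ⥤ PadicFld.{u} p)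
    {X Y : D} (f : X ⟶ Y) : Function.Injective ((bZeroOn base).map f.op).hom := by
  intro u v h
  apply Units.ext
  apply (base.map f).alg.injective
  exact congrArg (fun w : ((base.obj X).K)ˣ => (w : (base.obj X).K)) h

end PadicFrd

namespace BaseGaloisSystem

/-! ### §1 Fields and field maps of coset objects of `G_{ℚ_p}` through representatives -/

section CosetFields

variable (p : ℕ) [Fact p.Prime]

/-- The base point of the coset object `G_{ℚ_p}/V` has a representative. [cite: MochizukiFrdII2008, Ex 1.3 (i) p.11] -/
theorem exists_rep_basePt (X : CosetCat (GalFbar ℚ_[p])) :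
    ∃ x : GalFbar ℚ_[p],
      (x : X.carrier) = (basePt ((CosetCat.toConnected (isTempered_galFbar ℚ_[p])).obj X) : X.carrier) :=
  QuotientGroup.mk_surjective _

/-- **Membership in the field `ℚ̄_p^{Stab(x_X)}` of `X = G_{ℚ_p}/V`** through a representative `x` of the base point:
`a` is fixed by every `σ` with `x⁻¹ σ x ∈ V` (the stabiliser of `xV` is `x V x⁻¹`). [cite: MochizukiFrdII2008, Ex 1.3 (iii) pp.11-12] -/
theorem mem_fixFld_toConnected_iff (X : CosetCat (GalFbar ℚ_[p])) {x : GalFbar ℚ_[p]}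
    (hx : (x : X.carrier) = (basePt ((CosetCat.toConnected (isTempered_galFbar ℚ_[p])).obj X) : X.carrier))
    (a : Fbar ℚ_[p]) :
    a ∈ fixFld ℚ_[p] ((CosetCat.toConnected (isTempered_galFbar ℚ_[p])).obj X) ↔
      ∀ σ : GalFbar ℚ_[p], x⁻¹ * σ * x ∈ X.sg → σ a = a := by
  rw [mem_fixFld_iff]
  refine forall_congr' fun σ => ?_
  rw [← hx]
  have key : ((CosetCat.toConnected (isTempered_galFbar ℚ_[p])).obj X).obj.obj.ρ σ (x : X.carrier) =
      (x : X.carrier) ↔ x⁻¹ * σ * x ∈ X.sg := by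
    change ((σ * x : GalFbar ℚ_[p]) : X.carrier) = (x : X.carrier) ↔ _
    rw [eq_comm, QuotientGroup.eq, ← mul_assoc]
    rfl
  rw [key]

/-- **The field map of `f : G_{ℚ_p}/U → G_{ℚ_p}/V` through representatives** `x`, `y` of the base points and `c` of the
point `f(1·U) = cV`: `ℚ̄_p^{Stab(x_Y)} → ℚ̄_p^{Stab(x_X)}` is `a ↦ (x c y⁻¹)·a` (`x c y⁻¹` carries `x_Y` to `f(x_X)`;
`fieldMap_apply_of_ρ_eq`). [cite: MochizukiFrdII2008, Ex 1.3 (iii) pp.11-12] -/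
theorem galoisPadicFields_toConnected_map_apply {X Y : CosetCat (GalFbar ℚ_[p])} (f : X ⟶ Y)
    {x y c : GalFbar ℚ_[p]}
    (hx : (x : X.carrier) = (basePt ((CosetCat.toConnected (isTempered_galFbar ℚ_[p])).obj X) : X.carrier))
    (hy : (y : Y.carrier) = (basePt ((CosetCat.toConnected (isTempered_galFbar ℚ_[p])).obj Y) : Y.carrier))
    (hc : (c : Y.carrier) = CosetCat.pt f)
    (a : fixFld ℚ_[p] ((CosetCat.toConnected (isTempered_galFbar ℚ_[p])).obj Y)) :
    (fieldMap ((CosetCat.toConnected (isTempered_galFbar ℚ_[p])).map f) a : Fbar ℚ_[p]) =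
      (x * c * y⁻¹) (a : Fbar ℚ_[p]) := by
  apply fieldMap_apply_of_ρ_eq
  rw [← hx, ← hy]
  change ((x * c * y⁻¹ * y : GalFbar ℚ_[p]) : Y.carrier) = CosetCat.Hom.toFun f (x : X.carrier)
  rw [CosetCat.toFun_coe, ← hc, MulAction.Quotient.smul_coe, smul_eq_mul, inv_mul_cancel_right]

end CosetFields

/-! ### §2 The genuine base `Π/U ↦ Spec ℚ̄_p^{Stab}` through `φ : Π → G_{ℚ_p}`: the deck action is through `φ` -/

section GenuineBase

variable {p : ℕ} [Fact p.Prime] {G : Type} [Group G] [TopologicalSpace G]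
  (φ : G →* GalFbar ℚ_[p]) (hφ : IsOpenHom φ)

/-- **Action formula.**  Over the genuine base the deck transformation `r_g : Π/M → Π/M` goes to the field map
`a ↦ (x φ(g) x⁻¹)·a` of `K_{Π/M} = ℚ̄_p^{x φ(M) x⁻¹}` (`x` represents the base point): "`r_g` acts through `φ(g)`".
[cite: MochizukiFrdII2008, Thm 2.4 (ii) p.21] -/
theorem genuine_map_crightMul_apply (M : OpenNormalSubgroup G) (g : G) {x : GalFbar ℚ_[p]}
    (hx : (x : ((CosetCat.push φ hφ.isOpenMap).obj (cQ M)).carrier) =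
      (basePt ((CosetCat.toConnected (isTempered_galFbar ℚ_[p])).obj ((CosetCat.push φ hφ.isOpenMap).obj (cQ M))) :
        ((CosetCat.push φ hφ.isOpenMap).obj (cQ M)).carrier))
    (a : fixFld ℚ_[p] ((CosetCat.toConnected (isTempered_galFbar ℚ_[p])).obj ((CosetCat.push φ hφ.isOpenMap).obj (cQ M)))) :
    (fieldMap ((CosetCat.toConnected (isTempered_galFbar ℚ_[p])).map ((CosetCat.push φ hφ.isOpenMap).map (crightMul M g))) a :
      Fbar ℚ_[p]) = (x * φ g * x⁻¹) (a : Fbar ℚ_[p]) := by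
  have hc : (φ g : ((CosetCat.push φ hφ.isOpenMap).obj (cQ M)).carrier) =
      CosetCat.pt ((CosetCat.push φ hφ.isOpenMap).map (crightMul M g)) := by
    rw [CosetCat.pt_push_map, pt_crightMul, CosetCat.pushQuot_coe]
  exact galoisPadicFields_toConnected_map_apply p ((CosetCat.push φ hφ.isOpenMap).map (crightMul M g)) hx hx hc a

/-- **Every `b ∈ ℚ̄_p` (indeed its whole `G_{ℚ_p}`-orbit) lies in `K_{Π/N_k}` for `k ≫ 0`**: the stabiliser of `b`
contains an open normal subgroup `C` of `G_{ℚ_p}` (profinite), `φ⁻¹(C) ⊇ N_k` for large `k` (`φ` continuous, `N`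
cofinal), and then `Stab(x φ(N_k)) = x φ(N_k) x⁻¹ ⊆ C` fixes every `y·b`. [cite: MochizukiFrdII2008, Thm 2.4 (ii) p.21] -/
theorem exists_orbit_mem_fixFld_genuine (N : ℕ → OpenNormalSubgroup G)
    (hNb : ∀ U ∈ 𝓝 (1 : G), ∃ k, (N k : Set G) ⊆ U) (b : Fbar ℚ_[p]) :
    ∃ k, ∀ y : GalFbar ℚ_[p],
      y b ∈ fixFld ℚ_[p] ((CosetCat.toConnected (isTempered_galFbar ℚ_[p])).obj
        ((CosetCat.push φ hφ.isOpenMap).obj (cQ (N k)))) := by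
  haveI : IsGalois ℚ_[p] (Fbar ℚ_[p]) := {}
  haveI : FiniteDimensional ℚ_[p] (IntermediateField.adjoin ℚ_[p] ({b} : Set (Fbar ℚ_[p]))) :=
    IntermediateField.adjoin.finiteDimensional (Algebra.IsAlgebraic.isAlgebraic b).isIntegral
  obtain ⟨C, hC⟩ := ProfiniteGrp.exist_openNormalSubgroup_sub_open_nhds_of_one
    (IntermediateField.fixingSubgroup_isOpen (IntermediateField.adjoin ℚ_[p] ({b} : Set (Fbar ℚ_[p]))))
    (Subgroup.one_mem _)
  have hCb : ∀ τ : GalFbar ℚ_[p], τ ∈ C → τ b = b := fun τ hτ =>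
    (IntermediateField.mem_fixingSubgroup_iff _ _).mp (hC hτ) b (IntermediateField.mem_adjoin_simple_self ℚ_[p] b)
  have hCo : IsOpen (φ ⁻¹' (C : Set (GalFbar ℚ_[p]))) := C.toOpenSubgroup.isOpen.preimage hφ.continuous
  obtain ⟨k, hk⟩ := hNb (φ ⁻¹' (C : Set (GalFbar ℚ_[p])))
    (hCo.mem_nhds (show φ 1 ∈ (C : Set (GalFbar ℚ_[p])) by rw [map_one]; exact one_mem C))
  obtain ⟨x, hx⟩ := exists_rep_basePt p ((CosetCat.push φ hφ.isOpenMap).obj (cQ (N k)))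
  refine ⟨k, fun y => (mem_fixFld_toConnected_iff p _ hx (y b)).mpr fun σ hσ => ?_⟩
  obtain ⟨n, hn, hφn⟩ := (CosetCat.mem_mapOpen φ hφ.isOpenMap).mp hσ
  have hσC : σ ∈ C := by
    have h1 : φ n ∈ C := hk hn
    rw [hφn] at h1
    have h2 := C.isNormal'.conj_mem _ h1 x
    rwa [show x * (x⁻¹ * σ * x) * x⁻¹ = σ by group] at h2
  have hyσ : (y⁻¹ * σ * y) b = b := hCb _ (by
    have h := C.isNormal'.conj_mem _ hσC y⁻¹
    rw [inv_inv] at h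
    exact h)
  rw [AlgEquiv.mul_apply, AlgEquiv.mul_apply, AlgEquiv.aut_inv, AlgEquiv.symm_apply_eq] at hyσ
  exact hyσ

variable (N : ℕ → OpenNormalSubgroup G) (hN : Antitone N)

/-- **The kernel of the deck action of `Π` on `lim→_k K_{Π/N_k}^×` over the genuine base is `Ker(Π → G_{ℚ_p})`.**
For an open homomorphism `φ : Π → G_{ℚ_p}` and a cofinal antitone `N` (the universal pro-covering of `𝓑^temp(Π)⁰`),
`r_g` acts trivially on `lim→_k K_{Π/N_k}^×` iff `φ(g) = 1` — so the faithful quotient `Π/K` of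
`exists_normal_ker_colimMap_toAutCoset` IS print's `G = Im(Π) ⊆ G_{ℚ_p}` (p. 17).
[cite: MochizukiFrdII2008, Thm 2.4 (ii) p.21] -/
theorem colimMap_toAutCoset_genuine_eq_id_iff (hNb : ∀ U ∈ 𝓝 (1 : G), ∃ k, (N k : Set G) ⊆ U)
    [HasColimit (cosetSystem N hN ⋙ PadicFrd.bZeroOn
      (CosetCat.push φ hφ.isOpenMap ⋙ CosetCat.toConnected (isTempered_galFbar ℚ_[p]) ⋙ galoisPadicFields p))]
    (g : G) :
    colimMap (Functor.whiskerRight (toAutCoset N hN g).hom (PadicFrd.bZeroOn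
      (CosetCat.push φ hφ.isOpenMap ⋙ CosetCat.toConnected (isTempered_galFbar ℚ_[p]) ⋙ galoisPadicFields p))) = 𝟙 _ ↔
      φ g = 1 := by
  constructor
  · intro hcol
    apply AlgEquiv.ext
    intro b
    rw [AlgEquiv.one_apply]
    by_cases hb : b = 0
    · rw [hb, map_zero]
    obtain ⟨k, hk⟩ := exists_orbit_mem_fixFld_genuine φ hφ N hNb b
    obtain ⟨x, hx⟩ := exists_rep_basePt p ((CosetCat.push φ hφ.isOpenMap).obj (cQ (N k)))
    have hxb : x b ≠ 0 := (map_ne_zero_iff _ x.injective).mpr hb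
    let a : fixFld ℚ_[p] ((CosetCat.toConnected (isTempered_galFbar ℚ_[p])).obj
        ((CosetCat.push φ hφ.isOpenMap).obj (cQ (N k)))) := ⟨x b, hk x⟩
    have ha : (a : Fbar ℚ_[p]) ≠ 0 := hxb
    let u : (fixFld ℚ_[p] ((CosetCat.toConnected (isTempered_galFbar ℚ_[p])).obj
        ((CosetCat.push φ hφ.isOpenMap).obj (cQ (N k)))))ˣ :=
      Units.mk0 a (fun h => ha (by rw [h]; rfl))
    have h1 : (colimit.ι (cosetSystem N hN ⋙ PadicFrd.bZeroOn
        (CosetCat.push φ hφ.isOpenMap ⋙ CosetCat.toConnected (isTempered_galFbar ℚ_[p]) ⋙ galoisPadicFields p)) k)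
          (((Functor.whiskerRight (toAutCoset N hN g).hom (PadicFrd.bZeroOn
            (CosetCat.push φ hφ.isOpenMap ⋙ CosetCat.toConnected (isTempered_galFbar ℚ_[p]) ⋙ galoisPadicFields p))).app
              k) u) =
        (colimit.ι (cosetSystem N hN ⋙ PadicFrd.bZeroOn
          (CosetCat.push φ hφ.isOpenMap ⋙ CosetCat.toConnected (isTempered_galFbar ℚ_[p]) ⋙ galoisPadicFields p)) k) u := by
      rw [← ConcreteCategory.comp_apply, ← ι_colimMap, hcol, Category.comp_id]
    obtain ⟨j, f₁, f₂, h2⟩ := Concrete.colimit_exists_of_rep_eq _ _ _ h1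
    obtain rfl : f₁ = f₂ := Subsingleton.elim _ _
    have h3 := PadicFrd.bZeroOn_map_injective
      (CosetCat.push φ hφ.isOpenMap ⋙ CosetCat.toConnected (isTempered_galFbar ℚ_[p]) ⋙ galoisPadicFields p)
      (cproj (hN f₁.le)) h2
    have h4 := congrArg (fun w : (fixFld ℚ_[p] ((CosetCat.toConnected (isTempered_galFbar ℚ_[p])).obj
        ((CosetCat.push φ hφ.isOpenMap).obj (cQ (N k)))))ˣ => (w.val : Fbar ℚ_[p])) h3
    have h5 : (fieldMap ((CosetCat.toConnected (isTempered_galFbar ℚ_[p])).map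
        ((CosetCat.push φ hφ.isOpenMap).map (crightMul (N k) g))) a : Fbar ℚ_[p]) = (a : Fbar ℚ_[p]) := h4
    rw [genuine_map_crightMul_apply φ hφ (N k) g hx a] at h5
    change (x * φ g * x⁻¹) (x b) = x b at h5
    rw [AlgEquiv.mul_apply, AlgEquiv.mul_apply, AlgEquiv.aut_inv, AlgEquiv.symm_apply_apply] at h5
    exact x.injective h5
  · intro hg
    refine colimit.hom_ext fun k => ?_
    rw [ι_colimMap, Category.comp_id, Functor.whiskerRight_app]
    suffices h : (PadicFrd.bZeroOn (CosetCat.push φ hφ.isOpenMap ⋙ CosetCat.toConnected (isTempered_galFbar ℚ_[p]) ⋙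
        galoisPadicFields p)).map ((toAutCoset N hN g).hom.app k) = 𝟙 _ by
      rw [h]; exact Category.id_comp _
    suffices h : (CosetCat.push φ hφ.isOpenMap ⋙ CosetCat.toConnected (isTempered_galFbar ℚ_[p]) ⋙
        galoisPadicFields p).map (crightMul (N k) g) = 𝟙 _ by
      change (PadicFrd.bZero p).map ((CosetCat.push φ hφ.isOpenMap ⋙ CosetCat.toConnected (isTempered_galFbar ℚ_[p]) ⋙
          galoisPadicFields p).map (crightMul (N k) g)).op =
        𝟙 ((PadicFrd.bZero p).obj (op ((CosetCat.push φ hφ.isOpenMap ⋙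
          CosetCat.toConnected (isTempered_galFbar ℚ_[p]) ⋙ galoisPadicFields p).obj (cQ (N k)))))
      rw [h, op_id, CategoryTheory.Functor.map_id]
    obtain ⟨x, hx⟩ := exists_rep_basePt p ((CosetCat.push φ hφ.isOpenMap).obj (cQ (N k)))
    apply PadicFrd.PadicFld.hom_ext
    refine RingHom.ext fun a => Subtype.ext ?_
    have h := genuine_map_crightMul_apply φ hφ (N k) g hx a
    rw [hg, mul_one, mul_inv_cancel, AlgEquiv.one_apply] at h
    exact h

end GenuineBase

/-! ### §3 The pair descends to `Im φ₁ ≃* Im φ₂` — the printed `G₁ ⥲ G₂` -/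

section Descent

variable {p₁ p₂ : ℕ} [Fact p₁.Prime] [Fact p₂.Prime]
  {G : Type} [Group G] [TopologicalSpace G] {G₂ : Type} [Group G₂] [TopologicalSpace G₂]
  (φ₁ : G →* GalFbar ℚ_[p₁]) (hφ₁ : IsOpenHom φ₁) (φ₂ : G₂ →* GalFbar ℚ_[p₂]) (hφ₂ : IsOpenHom φ₂)
  (N : ℕ → OpenNormalSubgroup G) (hN : Antitone N) (N₂ : ℕ → OpenNormalSubgroup G₂) (hN₂ : Antitone N₂)

omit [TopologicalSpace G] [TopologicalSpace G₂] in
/-- **Group theory of the descent**: an isomorphism `φ : Π₁ ≃* Π₂` with `φ₁ g = 1 ↔ φ₂ (φ g) = 1` maps `Ker φ₁` onto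
`Ker φ₂` and induces `ψ : Im φ₁ ≃* Im φ₂` with `ψ (φ₁ g) = φ₂ (φ g)`. [cite: MochizukiFrdII2008, Thm 2.4 p.19] -/
theorem exists_rangeEquiv_of_ker_iff (φ : G ≃* G₂) (h : ∀ g : G, φ₁ g = 1 ↔ φ₂ (φ g) = 1) :
    φ₁.ker.map φ.toMonoidHom = φ₂.ker ∧
      ∃ ψ : φ₁.range ≃* φ₂.range, ∀ g : G, (ψ ⟨φ₁ g, ⟨g, rfl⟩⟩ : GalFbar ℚ_[p₂]) = φ₂ (φ g) := by
  have hmap : φ₁.ker.map φ.toMonoidHom = φ₂.ker := by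
    ext g₂
    rw [Subgroup.mem_map_equiv, MonoidHom.mem_ker, MonoidHom.mem_ker, h, MulEquiv.apply_symm_apply]
  refine ⟨hmap, ?_⟩
  let ψ : φ₁.range ≃* φ₂.range :=
    (QuotientGroup.quotientKerEquivRange φ₁).symm.trans
      ((QuotientGroup.congr φ₁.ker φ₂.ker φ hmap).trans (QuotientGroup.quotientKerEquivRange φ₂))
  refine ⟨ψ, fun g => ?_⟩
  have h1 : (QuotientGroup.quotientKerEquivRange φ₁).symm ⟨φ₁ g, ⟨g, rfl⟩⟩ = (g : G ⧸ φ₁.ker) := by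
    rw [MulEquiv.symm_apply_eq]
    rfl
  change (((QuotientGroup.quotientKerEquivRange φ₂) ((QuotientGroup.congr φ₁.ker φ₂.ker φ hmap)
    ((QuotientGroup.quotientKerEquivRange φ₁).symm ⟨φ₁ g, ⟨g, rfl⟩⟩)) : φ₂.range) : GalFbar ℚ_[p₂]) = _
  rw [h1, QuotientGroup.congr_mk]
  rfl

/-- **[FrdII] Thm. 2.4 (ii): the compatible pair DESCENDS to the printed `G₁ ⥲ G₂`, `Gᵢ = Im(Πᵢ → G_{ℚ_{pᵢ}})`.**  Over
the genuine bases (open homomorphisms `φᵢ : Πᵢ → G_{ℚ_{pᵢ}}`, cofinal antitone `N`, `N₂`), every `φ`-EQUIVARIANT pair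
(`φ : Π₁ ≃* Π₂`, `e : lim→_k K_{1,Π₁/N_k}^× ≅ lim→_k K_{2,Π₂/N₂,k}^×` with `e ∘ r_g = r_{φ g} ∘ e`) satisfies
`φ(Ker φ₁) = Ker φ₂` and induces `ψ : Im φ₁ ≃* Im φ₂` with `ψ ∘ φ₁ = φ₂ ∘ φ` — "`Π₁ ⥲ Π₂` … lies over … `G₁ ⥲ G₂`"
(p. 19), "a pair of compatible isomorphisms `G₁ ⥲ G₂`; `K̄₁^× ⥲ K̄₂^×`" (p. 21). [cite: MochizukiFrdII2008, Thm 2.4 (ii) p.21] -/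
theorem exists_rangeEquiv_of_equivariant
    (hNb : ∀ U ∈ 𝓝 (1 : G), ∃ k, (N k : Set G) ⊆ U) (hN₂b : ∀ U ∈ 𝓝 (1 : G₂), ∃ k, (N₂ k : Set G₂) ⊆ U)
    [HasColimit (cosetSystem N hN ⋙ PadicFrd.bZeroOn
      (CosetCat.push φ₁ hφ₁.isOpenMap ⋙ CosetCat.toConnected (isTempered_galFbar ℚ_[p₁]) ⋙ galoisPadicFields p₁))]
    [HasColimit (cosetSystem N₂ hN₂ ⋙ PadicFrd.bZeroOn
      (CosetCat.push φ₂ hφ₂.isOpenMap ⋙ CosetCat.toConnected (isTempered_galFbar ℚ_[p₂]) ⋙ galoisPadicFields p₂))]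
    (φ : G ≃* G₂)
    (e : colimit (cosetSystem N hN ⋙ PadicFrd.bZeroOn
        (CosetCat.push φ₁ hφ₁.isOpenMap ⋙ CosetCat.toConnected (isTempered_galFbar ℚ_[p₁]) ⋙ galoisPadicFields p₁)) ≅
      colimit (cosetSystem N₂ hN₂ ⋙ PadicFrd.bZeroOn
        (CosetCat.push φ₂ hφ₂.isOpenMap ⋙ CosetCat.toConnected (isTempered_galFbar ℚ_[p₂]) ⋙ galoisPadicFields p₂)))
    (he : ∀ g : G,
      e.hom ≫ colimMap (Functor.whiskerRight (toAutCoset N₂ hN₂ (φ g)).hom (PadicFrd.bZeroOn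
        (CosetCat.push φ₂ hφ₂.isOpenMap ⋙ CosetCat.toConnected (isTempered_galFbar ℚ_[p₂]) ⋙ galoisPadicFields p₂))) =
      colimMap (Functor.whiskerRight (toAutCoset N hN g).hom (PadicFrd.bZeroOn
        (CosetCat.push φ₁ hφ₁.isOpenMap ⋙ CosetCat.toConnected (isTempered_galFbar ℚ_[p₁]) ⋙ galoisPadicFields p₁))) ≫
        e.hom) :
    φ₁.ker.map φ.toMonoidHom = φ₂.ker ∧
      ∃ ψ : φ₁.range ≃* φ₂.range, ∀ g : G, (ψ ⟨φ₁ g, ⟨g, rfl⟩⟩ : GalFbar ℚ_[p₂]) = φ₂ (φ g) := by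
  refine exists_rangeEquiv_of_ker_iff φ₁ φ₂ φ fun g => ?_
  rw [← colimMap_toAutCoset_genuine_eq_id_iff φ₁ hφ₁ N hN hNb g,
    ← colimMap_toAutCoset_genuine_eq_id_iff φ₂ hφ₂ N₂ hN₂ hN₂b (φ g)]
  exact colimMap_toAutCoset_eq_id_iff_of_equivariant N hN N₂ hN₂ _ _ φ e he g

end Descent

/-! ### §4 The assembled printed statement at the genuine bases -/

section Assembled

variable {p₁ p₂ : ℕ} [Fact p₁.Prime] [Fact p₂.Prime]
  {G : Type} [Group G] [TopologicalSpace G] (hG : IsTempered G)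
  {G₂ : Type} [Group G₂] [TopologicalSpace G₂] [IsTopologicalGroup G₂] (hG₂ : IsTempered G₂)
  (φ₁ : G →* GalFbar ℚ_[p₁]) (hφ₁ : IsOpenHom φ₁) (φ₂ : G₂ →* GalFbar ℚ_[p₂]) (hφ₂ : IsOpenHom φ₂)
  (N : ℕ → OpenNormalSubgroup G) (hN : Antitone N)
  (d₁ : PadicFrd.Datum (CosetCat G) p₁) (d₂ : PadicFrd.Datum (CosetCat G₂) p₂)

include hG hG₂ in
/-- **[FrdII] Thm. 2.4 (ii) — "`Ψ` induces a pair of compatible isomorphisms `G₁ ⥲ G₂`; `K̄₁^× ⥲ K̄₂^×`", with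
`Gᵢ := Im(Πᵢ) ⊆ G_{ℚ_{pᵢ}}` (p. 17), at the genuine bases.**  For FIELDWISE SATURATED `pᵢ`-adic Frobenioid data over
`𝓑^temp(Πᵢ)⁰` (small models `CosetCat Πᵢ`, `Πᵢ` tempered) whose base functors ARE
`Πᵢ/U ↦ Spec ℚ̄_{pᵢ}^{Stab}` through open homomorphisms `φᵢ : Πᵢ → G_{ℚ_{pᵢ}}`, an equivalence of bases `E = Ψ^Base` with
the row-L02 slot `ΨB : B₁ ≅ E^op ⋙ B₂`, and a cofinal antitone `N` for `Π₁`: there are `φ : Π₁ ≃* Π₂` with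
`φ(Ker φ₁) = Ker φ₂`, the DESCENDED `ψ : G₁ = Im φ₁ ≃* Im φ₂ = G₂` with `ψ ∘ φ₁ = φ₂ ∘ φ`, a cofinal antitone `N₂` for
`Π₂`, and a `φ`-equivariant `e : lim→_k K_{1,Π₁/N_k}^× ≅ lim→_k K_{2,Π₂/N₂,k}^×` ("`K̄₁^× ⥲ K̄₂^×`"); "well-defined up to …
elements of `G₂`" = the choice of the straightening. [cite: MochizukiFrdII2008, Thm 2.4 (ii) p.21] -/
theorem exists_pairIso_range
    (hd₁ : d₁.base = CosetCat.push φ₁ hφ₁.isOpenMap ⋙ CosetCat.toConnected (isTempered_galFbar ℚ_[p₁]) ⋙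
      galoisPadicFields p₁)
    (hd₂ : d₂.base = CosetCat.push φ₂ hφ₂.isOpenMap ⋙ CosetCat.toConnected (isTempered_galFbar ℚ_[p₂]) ⋙
      galoisPadicFields p₂)
    (hfs₁ : d₁.IsFieldwiseSaturated) (hfs₂ : d₂.IsFieldwiseSaturated)
    (E : CosetCat G ≌ CosetCat G₂) (ΨB : d₁.B ≅ E.functor.op ⋙ d₂.B)
    (hNb : ∀ U ∈ 𝓝 (1 : G), ∃ k, (N k : Set G) ⊆ U) :
    haveI := hasColimitsOfShape_nat_commMonCat.{0}
    ∃ (φ : G ≃* G₂) (ψ : φ₁.range ≃* φ₂.range) (N₂ : ℕ → OpenNormalSubgroup G₂) (hN₂ : Antitone N₂)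
      (_ : ∀ U ∈ 𝓝 (1 : G₂), ∃ k, (N₂ k : Set G₂) ⊆ U)
      (e : colimit (cosetSystem N hN ⋙ PadicFrd.bZeroOn d₁.base) ≅
        colimit (cosetSystem N₂ hN₂ ⋙ PadicFrd.bZeroOn d₂.base)),
      φ₁.ker.map φ.toMonoidHom = φ₂.ker ∧
      (∀ g : G, (ψ ⟨φ₁ g, ⟨g, rfl⟩⟩ : GalFbar ℚ_[p₂]) = φ₂ (φ g)) ∧
      ∀ g : G, e.hom ≫ colimMap (Functor.whiskerRight (toAutCoset N₂ hN₂ (φ g)).hom (PadicFrd.bZeroOn d₂.base)) =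
        colimMap (Functor.whiskerRight (toAutCoset N hN g).hom (PadicFrd.bZeroOn d₁.base)) ≫ e.hom := by
  haveI := hasColimitsOfShape_nat_commMonCat.{0}
  obtain ⟨base₁, hloc₁, hc₁, he₁, Φ₁, ι₁, hι₁, hmono₁, B₁, toB0₁, divB₁, sq₁, cart₁, nz₁⟩ := d₁
  obtain ⟨base₂, hloc₂, hc₂, he₂, Φ₂, ι₂, hι₂, hmono₂, B₂, toB0₂, divB₂, sq₂, cart₂, nz₂⟩ := d₂
  cases hd₁
  cases hd₂
  obtain ⟨φ, N₂, hN₂, hN₂b, e, he⟩ :=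
    exists_pairIso_of_isFieldwiseSaturated hG hG₂ N hN _ _ hfs₁ hfs₂ E ΨB hNb
  obtain ⟨hker, ψ, hψ⟩ :=
    exists_rangeEquiv_of_equivariant φ₁ hφ₁ φ₂ hφ₂ N hN N₂ hN₂ hNb hN₂b φ e he
  exact ⟨φ, ψ, N₂, hN₂, hN₂b, e, hker, hψ, he⟩

end Assembled

/-! ### §5 Non-vacuity: every genuine base carries fieldwise saturated data, and the statement fires -/

section NonVacuity

variable {p : ℕ} [Fact p.Prime] {G : Type} [Group G] [TopologicalSpace G] [IsTopologicalGroup G]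
  [SecondCountableTopology G] (hG : IsTempered G) (φ₀ : G →* GalFbar ℚ_[p]) (hφ₀ : IsOpenHom φ₀)

omit [IsTopologicalGroup G] [SecondCountableTopology G] in
/-- `ord(O_K^⊳)` is monoprime at every value of the genuine base `Π/U ↦ Spec ℚ̄_p^{Stab}` (the input `hmono` of
`PadicFrd.Datum.zero`: every value is a finite extension of `ℚ_p` with THE `p`-adic valuation).
[cite: MochizukiFrdII2008, Ex 1.1 (i) p.7] -/
theorem isMonoprime_ordInt_genuine (A : CosetCat G) :
    IsMonoprime (PadicFrd.OrdInt ((CosetCat.push φ₀ hφ₀.isOpenMap ⋙ CosetCat.toConnected (isTempered_galFbar ℚ_[p]) ⋙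
      galoisPadicFields p).obj A).K) :=
  (isPadicLocal_galoisPadicFields p _).isMonoprime_ordInt

include hG in
/-- **Kernel instance over an arbitrary genuine base.**  For `Π` tempered and Galois-countable with an open
homomorphism `φ₀ : Π → G_{ℚ_p}`, the `p`-adic Frobenioid `C₀|_D` of Ex. 1.1 (i)/(ii) over `D = 𝓑^temp(Π)⁰ → D₀`
(`PadicFrd.Datum.zero` at the genuine base, fieldwise saturated by `isFieldwiseSaturated_zero`) and `Ψ = 𝟭`
(`Ψ^Base = 𝟭`, `ΨB = 𝟙`): EVERY hypothesis of `exists_pairIso_range` is met, and the printed pair with its descent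
`ψ : Im φ₀ ≃* Im φ₀` exists (no-hypothesis instance: `Π = G_{ℚ_p}`, `φ₀ = id`, via `isTempered_galFbar`,
`QuasiTemperoid.secondCountableTopology_galFbar_padic`, `⟨continuous_id, IsOpenMap.id⟩`). [cite: MochizukiFrdII2008, Thm 2.4 (ii) p.21] -/
theorem exists_pairIso_range_zero :
    haveI := hasColimitsOfShape_nat_commMonCat.{0}
    let d : PadicFrd.Datum (CosetCat G) p :=
      PadicFrd.Datum.zero (CosetCat.push φ₀ hφ₀.isOpenMap ⋙ CosetCat.toConnected (isTempered_galFbar ℚ_[p]) ⋙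
          galoisPadicFields p) (fun _ => isPadicLocal_galoisPadicFields p _) CosetCat.isConnected
        CosetCat.isTotallyEpimorphic (isMonoprime_ordInt_genuine φ₀ hφ₀)
    ∃ (N : ℕ → OpenNormalSubgroup G) (hN : Antitone N) (_ : ∀ U ∈ 𝓝 (1 : G), ∃ k, (N k : Set G) ⊆ U)
      (φ : G ≃* G) (ψ : φ₀.range ≃* φ₀.range) (N₂ : ℕ → OpenNormalSubgroup G) (hN₂ : Antitone N₂)
      (_ : ∀ U ∈ 𝓝 (1 : G), ∃ k, (N₂ k : Set G) ⊆ U)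
      (e : colimit (cosetSystem N hN ⋙ PadicFrd.bZeroOn d.base) ≅
        colimit (cosetSystem N₂ hN₂ ⋙ PadicFrd.bZeroOn d.base)),
      φ₀.ker.map φ.toMonoidHom = φ₀.ker ∧
      (∀ g : G, (ψ ⟨φ₀ g, ⟨g, rfl⟩⟩ : GalFbar ℚ_[p]) = φ₀ (φ g)) ∧
      ∀ g : G, e.hom ≫ colimMap (Functor.whiskerRight (toAutCoset N₂ hN₂ (φ g)).hom (PadicFrd.bZeroOn d.base)) =
        colimMap (Functor.whiskerRight (toAutCoset N hN g).hom (PadicFrd.bZeroOn d.base)) ≫ e.hom := by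
  haveI := hasColimitsOfShape_nat_commMonCat.{0}
  obtain ⟨N, hN, hNb⟩ := exists_antitone_cofinal_seq hG
  obtain ⟨φ, ψ, N₂, hN₂, hN₂b, e, hker, hψ, he⟩ := exists_pairIso_range hG hG φ₀ hφ₀ φ₀ hφ₀ N hN _ _ rfl rfl
    (PadicFrd.Datum.isFieldwiseSaturated_zero _ _ _ _ _) (PadicFrd.Datum.isFieldwiseSaturated_zero _ _ _ _ _)
    CategoryTheory.Equivalence.refl (Iso.refl _) hNb
  exact ⟨N, hN, hNb, φ, ψ, N₂, hN₂, hN₂b, e, hker, hψ, he⟩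

end NonVacuity

end BaseGaloisSystem

end Literature.AlgebraicGeometry.Frobenioids

end
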